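import Summits.AtomisticToContinuum.HydrodynamicLimit.Theorems.CollisionIsometryCLTAdaptedWeightCLTTLPastDampingDensityCap
import Summits.AtomisticToContinuum.HydrodynamicLimit.Theorems.CollisionIsometryCLTAdaptedWeightCLTTLReductionDictionary
import Literature.Analysis.FluidPDE.ReleaseLogBoundDatum
import Literature.Analysis.FluidPDE.HardSpherePhaseSpaceProofs
import Mathlib.MeasureTheory.Measure.Haar.Unique

/-!
# Stub `stub_pastDamping` of the line `contact-source-duhamel` — helper file: KERNEL AND VELOCITY
BOOKKEEPING (crux `CollisionIsometryCLT.AdaptedWeightCLT`, stmt-AtomisticToContinuum-14868,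
`--supports`)

Dynamics-free facts about the block weights `w_i(s, x) = φ_N(x_i(s) − x)` of an admissible kernel
family, the block velocity `ū(s, x)` and velocity cut-offs, consumed by the `x`-integration of the
PAST estimate:

* UNIT MASS: `∫ₓ w_i(s, x) dx = 1` (`integral_wgt`; the Haar measure of `𝕋³` is translation- and
  negation-invariant, `Measure.IsAddHaarMeasure.isNegInvariant_of_regular`);
* `L¹`-LIPSCHITZ TRANSLATES: `∫ₓ |φ_N(p − x) − φ_N(q − x)| dx ≤ lipK · d(p, q)` with
  `lipK = 2 (N+1)^{-3γ} |B₁| · √3 C (N+1)^{4γ}` (`integral_abs_kernel_sub_le`: the mean value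
  inequality on the torus, `Torus.abs_sub_le_of_norm_gradient_le`, the sup-distance is dominated by
  the minimal-image distance, and the integrand lives on two minimal-image balls of radius
  `(N+1)^{-γ}`, whose Haar volume is Euclidean, `volume_euclidDist_lt_eq`);
* VELOCITY CUT-OFF: the fast part `fastPow p V v = ‖v‖^p 𝟙{‖v‖ > V}` of a power, its domination by
  the exponential moment `fastPow p V v ≤ p!/(λV)^p · e^{λ‖v‖²}` (`fastPow_le_exp`), and
  `‖v‖² ≤ λ⁻¹ e^{λ‖v‖²}`;
* JENSEN FOR THE BLOCK VELOCITY: `(Σ_i w_i) ‖ū‖^p ≤ 2^{p-1} (V^p Σ_i w_i + Σ_i w_i fastPow p V v_i)`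
  (`sum_wgt_mul_norm_ubar_pow_le`: `ū` is the `w`-average of the velocities, convexity of `t^p`,
  `Real.pow_arith_mean_le_arith_mean_pow`);
* the Frobenius norms of the twelve tests are at most `1` (`normSqT_C2_le_one`, `normSqT_C3_le_one`),
  and the exponential moment of the empirical measure is the normalised sum (`expMoment_eq`).
-/

namespace Summit.AtomisticToContinuum.HydrodynamicLimit.Theorems.ContactSourceDuhamel.TimeLocal
namespace PastDamping

open scoped BigOperators Topology Classical MeasureTheory ENNReal InnerProductSpace
open Filter Set MeasureTheory Metric
open Literature.Analysis.FluidPDE Literature.Analysis.FluidPDE.Torus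

noncomputable section

variable {σ : ℝ} {N : ℕ}

/-! ## Haar bookkeeping on `𝕋³` -/

/-- `∫ f(p − x) dx = ∫ f` (the Haar measure of `𝕋³`, a regular additive Haar measure on an abelian
group, is invariant under negation, `Measure.IsAddHaarMeasure.isNegInvariant_of_regular`). -/
theorem integral_comp_sub_left (f : T3 → ℝ) (p : T3) : ∫ x, f (p - x) = ∫ x, f x := by
  haveI : (volume : Measure T3).IsNegInvariant :=
    Measure.IsAddHaarMeasure.isNegInvariant_of_regular volume
  exact integral_sub_left_eq_self f volume p

/-- **The block weights have unit mass**: `∫ₓ w_i(s, x) dx = 1` for an admissible kernel family. -/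
theorem integral_wgt {γ C : ℝ} {φ : ℕ → T3 → ℝ} (hadm : AdmissibleKernel γ C φ) (Φ : Flow σ N)
    (s : ℝ) (z : Cfg N) (i : Fin (N + 1)) : ∫ x, wgt σ N Φ φ s z x i = 1 := by
  unfold wgt
  rw [integral_comp_sub_left (φ N)]
  exact hadm.2.2.1 N

/-- A continuous real function on `𝕋³` is integrable. -/
theorem integrable_of_continuous_T3 {f : T3 → ℝ} (hf : Continuous f) : Integrable f := by
  obtain ⟨B, hB⟩ := (isCompact_univ.image hf).isBounded.subset_closedBall 0
  refine Integrable.of_bound hf.aestronglyMeasurable B (ae_of_all _ fun x => ?_)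
  have hx := hB ⟨x, Set.mem_univ x, rfl⟩
  rwa [mem_closedBall, dist_zero_right] at hx

/-! ## The kernel is Lipschitz in `L¹` under translation -/

/-- The volume of the Euclidean unit ball of `ℝ³` (an opaque positive constant). -/
def ballVol : ℝ := (volume (ball (0 : V3) 1)).toReal

/-- `0 ≤ |B₁|`. -/
theorem ballVol_nonneg : 0 ≤ ballVol := ENNReal.toReal_nonneg

/-- The Haar volume (as a real number) of a small minimal-image ball. -/
theorem volumeReal_euclidDist_lt (c : T3) {R : ℝ} (hR : 0 < R) (hR' : R < 1 / 2) :
    (volume {x : T3 | euclidDist x c < R}).toReal = R ^ 3 * ballVol := by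
  rw [volume_euclidDist_lt_eq c hR hR', ENNReal.toReal_mul, ENNReal.toReal_ofReal (pow_nonneg hR.le 3),
    ballVol]

/-- The `L¹`-Lipschitz constant of the translates of an admissible kernel:
`2 R³ |B₁| · √3 C (N+1)^{4γ}`, `R = (N+1)^{-γ}` (of order `N^{γ}`). -/
def lipK (C γ : ℝ) (N : ℕ) : ℝ :=
  2 * ((((N : ℝ) + 1) ^ (-γ)) ^ 3 * ballVol) * (Real.sqrt 3 * (C * ((N : ℝ) + 1) ^ (4 * γ)))

/-- **`L¹`-Lipschitz translates.** For an admissible kernel family with `(N+1)^{-γ} < 1/2`: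
`∫ₓ |φ_N(p − x) − φ_N(q − x)| dx ≤ lipK · d(p, q)`. -/
theorem integral_abs_kernel_sub_le {γ C : ℝ} {φ : ℕ → T3 → ℝ} (hadm : AdmissibleKernel γ C φ)
    (hR : ((N : ℝ) + 1) ^ (-γ) < 1 / 2) (p q : T3) :
    ∫ x, |φ N (p - x) - φ N (q - x)| ≤ lipK C γ N * euclidDist p q := by
  obtain ⟨hsm, h0, -, hsupp, hC, hgrad⟩ := hadm
  set R : ℝ := ((N : ℝ) + 1) ^ (-γ) with hRdef
  have hR0 : 0 < R := Real.rpow_pos_of_pos (by positivity) _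
  set L : ℝ := Real.sqrt 3 * (C * ((N : ℝ) + 1) ^ (4 * γ)) with hL
  have hC0 : 0 ≤ C := by
    have h := (h0 N 0).trans (hC N 0)
    have hpow : 0 < ((N : ℝ) + 1) ^ (3 * γ) := Real.rpow_pos_of_pos (by positivity) _
    nlinarith
  have hL0 : 0 ≤ L := by positivity
  have hd0 : 0 ≤ euclidDist p q := norm_nonneg _
  have hLd : 0 ≤ L * euclidDist p q := mul_nonneg hL0 hd0
  set Bp : Set T3 := {x | euclidDist x p < R} with hBp
  set Bq : Set T3 := {x | euclidDist x q < R} with hBq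
  have hBpm : MeasurableSet Bp := measurableSet_euclidDist_lt p R
  have hBqm : MeasurableSet Bq := measurableSet_euclidDist_lt q R
  -- pointwise domination
  set g : T3 → ℝ := fun x => L * euclidDist p q * (Bp.indicator 1 x + Bq.indicator 1 x) with hg
  have hdom : ∀ x, |φ N (p - x) - φ N (q - x)| ≤ g x := by
    intro x
    have hlip : |φ N (p - x) - φ N (q - x)| ≤ L * euclidDist p q := by
      have h1 := abs_sub_le_of_norm_gradient_le (hsm N) (hgrad N) (p - x) (q - x)
      have hcard : Real.sqrt (Fintype.card (Fin 3)) = Real.sqrt 3 := by norm_num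
      rw [hcard, sub_sub_sub_cancel_right] at h1
      refine h1.trans ?_
      rw [hL, mul_assoc (Real.sqrt 3), mul_assoc (Real.sqrt 3)]
      refine mul_le_mul_of_nonneg_left (mul_le_mul_of_nonneg_left
        (norm_sub_le_euclidDist_holds p q) (by positivity)) (Real.sqrt_nonneg _)
    by_cases hx : x ∈ Bp ∨ x ∈ Bq
    · have hind : (1 : ℝ) ≤ Bp.indicator 1 x + Bq.indicator 1 x := by
        rcases hx with hx | hx
        · rw [indicator_of_mem hx]
          have : 0 ≤ Bq.indicator (1 : T3 → ℝ) x := indicator_nonneg (fun _ _ => zero_le_one) x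
          simp only [Pi.one_apply]; linarith
        · rw [indicator_of_mem hx]
          have : 0 ≤ Bp.indicator (1 : T3 → ℝ) x := indicator_nonneg (fun _ _ => zero_le_one) x
          simp only [Pi.one_apply]; linarith
      calc |φ N (p - x) - φ N (q - x)| ≤ L * euclidDist p q * 1 := by rw [mul_one]; exact hlip
        _ ≤ g x := mul_le_mul_of_nonneg_left hind hLd
    · simp only [not_or] at hx
      have hp0 : φ N (p - x) = 0 := by
        refine hsupp N _ ?_
        rw [euclidDist_sub_zero, euclidDist_comm]
        exact not_lt.1 hx.1
      have hq0 : φ N (q - x) = 0 := by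
        refine hsupp N _ ?_
        rw [euclidDist_sub_zero, euclidDist_comm]
        exact not_lt.1 hx.2
      rw [hp0, hq0, sub_zero, abs_zero]
      exact mul_nonneg hLd (add_nonneg (indicator_nonneg (fun _ _ => zero_le_one) x)
        (indicator_nonneg (fun _ _ => zero_le_one) x))
  -- integrate
  have hgi : Integrable g := by
    refine Integrable.const_mul (Integrable.add ?_ ?_) _
    · exact (integrable_const 1).indicator hBpm
    · exact (integrable_const 1).indicator hBqm
  have hfi : Integrable fun x => |φ N (p - x) - φ N (q - x)| := by
    have hc : Continuous (φ N) := (hsm N).continuous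
    exact (integrable_of_continuous_T3 ((hc.comp (continuous_const.sub continuous_id)).sub
      (hc.comp (continuous_const.sub continuous_id)))).abs
  calc ∫ x, |φ N (p - x) - φ N (q - x)| ≤ ∫ x, g x := integral_mono hfi hgi hdom
    _ = L * euclidDist p q * ((volume Bp).toReal + (volume Bq).toReal) := by
        rw [hg, integral_const_mul, integral_add ((integrable_const 1).indicator hBpm)
          ((integrable_const 1).indicator hBqm), integral_indicator_one hBpm,
          integral_indicator_one hBqm]
        rfl
    _ = lipK C γ N * euclidDist p q := by
        rw [hBp, hBq, volumeReal_euclidDist_lt p hR0 hR, volumeReal_euclidDist_lt q hR0 hR, lipK]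
        ring

/-- The block weights of an admissible kernel family are `L¹`-Lipschitz in the particle:
`∫ₓ |w_i(s, x) − w_k(s, x)| dx ≤ lipK · d(x_i(s), x_k(s))`. -/
theorem integral_abs_wgt_sub_le {γ C : ℝ} {φ : ℕ → T3 → ℝ} (hadm : AdmissibleKernel γ C φ)
    (hR : ((N : ℝ) + 1) ^ (-γ) < 1 / 2) (Φ : Flow σ N) (s : ℝ) (z : Cfg N) (i k : Fin (N + 1)) :
    ∫ x, |wgt σ N Φ φ s z x i - wgt σ N Φ φ s z x k| ≤
      lipK C γ N * euclidDist (Φ.flow s z i).1 (Φ.flow s z k).1 :=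
  integral_abs_kernel_sub_le hadm hR _ _

/-- `0 ≤ lipK` for `C ≥ 0`. -/
theorem lipK_nonneg {C : ℝ} (hC : 0 ≤ C) (γ : ℝ) (N : ℕ) : 0 ≤ lipK C γ N := by
  unfold lipK
  have : 0 ≤ ((N : ℝ) + 1) ^ (-γ) := Real.rpow_nonneg (by positivity) _
  have : 0 ≤ ((N : ℝ) + 1) ^ (4 * γ) := Real.rpow_nonneg (by positivity) _
  have := ballVol_nonneg
  positivity

/-! ## Velocity cut-offs -/

/-- The FAST PART of the `p`-th power of a velocity: `‖v‖^p` above the cut-off `V`, `0` below. -/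
def fastPow (p : ℕ) (V : ℝ) (v : V3) : ℝ := if V < ‖v‖ then ‖v‖ ^ p else 0

/-- `0 ≤ fastPow`. -/
theorem fastPow_nonneg (p : ℕ) (V : ℝ) (v : V3) : 0 ≤ fastPow p V v := by
  unfold fastPow
  split_ifs
  · exact pow_nonneg (norm_nonneg _) p
  · exact le_rfl

/-- Cut-off: `‖v‖^p ≤ V^p + fastPow p V v` (`V ≥ 0`). -/
theorem norm_pow_le_add_fastPow {V : ℝ} (hV : 0 ≤ V) (p : ℕ) (v : V3) :
    ‖v‖ ^ p ≤ V ^ p + fastPow p V v := by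
  unfold fastPow
  split_ifs with h
  · linarith [pow_nonneg hV p]
  · have : ‖v‖ ^ p ≤ V ^ p := pow_le_pow_left₀ (norm_nonneg _) (not_lt.1 h) p
    linarith

/-- The fast part of a power is the power of the fast part of the norm (`p ≥ 1`). -/
theorem fastPow_one_pow {p : ℕ} (hp : 1 ≤ p) (V : ℝ) (v : V3) : fastPow 1 V v ^ p = fastPow p V v := by
  unfold fastPow
  split_ifs
  · rw [pow_one]
  · exact zero_pow (by omega)

/-- **The exponential moment dominates the fast moments**: `fastPow p V v ≤ p!/(λV)^p · e^{λ‖v‖²}`. -/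
theorem fastPow_le_exp {lam V : ℝ} (hlam : 0 < lam) (hV : 0 < V) (p : ℕ) (v : V3) :
    fastPow p V v ≤ (p.factorial / (lam * V) ^ p) * Real.exp (lam * ‖v‖ ^ 2) := by
  have hrhs : 0 ≤ (p.factorial / (lam * V) ^ p) * Real.exp (lam * ‖v‖ ^ 2) := by positivity
  unfold fastPow
  split_ifs with h
  · have hv : 0 < ‖v‖ := hV.trans h
    have hx : 0 ≤ lam * ‖v‖ ^ 2 := by positivity
    have h1 := Real.pow_div_factorial_le_exp (lam * ‖v‖ ^ 2) hx p
    have hfact : (0 : ℝ) < p.factorial := by exact_mod_cast Nat.factorial_pos p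
    rw [div_le_iff₀ hfact] at h1
    -- `‖v‖^p ≤ ‖v‖^{2p} / V^p`
    have h2 : ‖v‖ ^ p * (lam * V) ^ p ≤ (lam * ‖v‖ ^ 2) ^ p := by
      rw [← mul_pow]
      refine pow_le_pow_left₀ (by positivity) ?_ p
      nlinarith [mul_pos hlam hv]
    have hden : 0 < (lam * V) ^ p := by positivity
    rw [div_mul_eq_mul_div, le_div_iff₀ hden]
    linarith
  · exact hrhs

/-- `‖v‖² ≤ λ⁻¹ e^{λ‖v‖²}` (`λ > 0`). -/
theorem sq_norm_le_inv_mul_exp {lam : ℝ} (hlam : 0 < lam) (v : V3) :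
    ‖v‖ ^ 2 ≤ lam⁻¹ * Real.exp (lam * ‖v‖ ^ 2) := by
  rw [le_inv_mul_iff₀ hlam]
  linarith [Real.add_one_le_exp (lam * ‖v‖ ^ 2)]

/-! ## Jensen for the block velocity -/

/-- **Jensen for the block velocity.** With the block weights `w_i ≥ 0` and the block velocity `ū`
(the `w`-average of the velocities, `0/0 = 0`), for `p ≥ 1` and a cut-off `V ≥ 0`:
`(Σ_i w_i) ‖ū‖^p ≤ 2^{p−1} (V^p Σ_i w_i + Σ_i w_i fastPow p V v_i)`. -/
theorem sum_wgt_mul_norm_ubar_pow_le (Φ : Flow σ N) {φ : ℕ → T3 → ℝ} (hφ0 : ∀ y, 0 ≤ φ N y)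
    (s : ℝ) (z : Cfg N) (x : T3) {p : ℕ} (hp : 1 ≤ p) {V : ℝ} (hV : 0 ≤ V) :
    (∑ i, wgt σ N Φ φ s z x i) * ‖ubar σ N Φ φ s z x‖ ^ p ≤
      2 ^ (p - 1) * (V ^ p * ∑ i, wgt σ N Φ φ s z x i +
        ∑ i, wgt σ N Φ φ s z x i * fastPow p V (Φ.flow s z i).2) := by
  set w : Fin (N + 1) → ℝ := fun i => wgt σ N Φ φ s z x i with hw
  have hw0 : ∀ i, 0 ≤ w i := fun i => hφ0 _
  set W := ∑ i, w i with hW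
  have hW0 : 0 ≤ W := Finset.sum_nonneg fun i _ => hw0 i
  have hfast0 : 0 ≤ ∑ i, w i * fastPow p V (Φ.flow s z i).2 :=
    Finset.sum_nonneg fun i _ => mul_nonneg (hw0 i) (fastPow_nonneg _ _ _)
  rcases hW0.eq_or_lt with hW00 | hWpos
  · -- no weight: both sides vanish
    rw [← hW00, zero_mul]
    positivity
  · -- `ū = W⁻¹ Σ w_i v_i`
    have hN : (0 : ℝ) < ((N + 1 : ℕ) : ℝ) := by positivity
    have hu : ubar σ N Φ φ s z x = W⁻¹ • ∑ i, w i • (Φ.flow s z i).2 := by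
      rw [Reduction.ubar_eq, smul_smul]
      congr 1
      change ((((N + 1 : ℕ) : ℝ))⁻¹ * W)⁻¹ * (((N + 1 : ℕ) : ℝ))⁻¹ = W⁻¹
      field_simp
    -- `‖ū‖ ≤ V + Σ (w_i/W) f_i`
    set a : Fin (N + 1) → ℝ := fun i => w i / W with ha
    have ha0 : ∀ i ∈ Finset.univ, 0 ≤ a i := fun i _ => div_nonneg (hw0 i) hWpos.le
    have ha1 : ∑ i ∈ Finset.univ, a i = 1 := by
      rw [ha]; simp only; rw [← Finset.sum_div, ← hW, div_self hWpos.ne']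
    set f : Fin (N + 1) → ℝ := fun i => fastPow 1 V (Φ.flow s z i).2 with hf
    have hf0 : ∀ i ∈ Finset.univ, 0 ≤ f i := fun i _ => fastPow_nonneg _ _ _
    have hnorm : ‖ubar σ N Φ φ s z x‖ ≤ V + ∑ i, a i * f i := by
      rw [hu, norm_smul, Real.norm_eq_abs, abs_inv, abs_of_pos hWpos]
      calc W⁻¹ * ‖∑ i, w i • (Φ.flow s z i).2‖ ≤ W⁻¹ * ∑ i, w i * ‖(Φ.flow s z i).2‖ := by
            refine mul_le_mul_of_nonneg_left ((norm_sum_le _ _).trans (le_of_eq ?_))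
              (inv_nonneg.2 hWpos.le)
            refine Finset.sum_congr rfl fun i _ => ?_
            rw [norm_smul, Real.norm_eq_abs, abs_of_nonneg (hw0 i)]
        _ ≤ W⁻¹ * ∑ i, w i * (V + f i) := by
            refine mul_le_mul_of_nonneg_left (Finset.sum_le_sum fun i _ =>
              mul_le_mul_of_nonneg_left ?_ (hw0 i)) (inv_nonneg.2 hWpos.le)
            have h := norm_pow_le_add_fastPow hV 1 (Φ.flow s z i).2
            rwa [pow_one, pow_one] at h
        _ = V + ∑ i, a i * f i := by
            have hsplit : ∑ i, w i * (V + f i) = W * V + ∑ i, w i * f i := by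
              rw [hW, Finset.sum_mul, ← Finset.sum_add_distrib]
              exact Finset.sum_congr rfl fun i _ => by ring
            rw [hsplit, mul_add, ← mul_assoc, inv_mul_cancel₀ hWpos.ne', one_mul, Finset.mul_sum]
            congr 1
            refine Finset.sum_congr rfl fun i _ => ?_
            rw [ha]
            ring
    -- convexity
    have hmean : (∑ i, a i * f i) ^ p ≤ ∑ i, a i * f i ^ p :=
      Real.pow_arith_mean_le_arith_mean_pow Finset.univ a f ha0 ha1 hf0 p
    have hsum0 : 0 ≤ ∑ i, a i * f i := Finset.sum_nonneg fun i hi => mul_nonneg (ha0 i hi) (hf0 i hi)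
    have hpow : ‖ubar σ N Φ φ s z x‖ ^ p ≤ 2 ^ (p - 1) * (V ^ p + ∑ i, a i * f i ^ p) :=
      calc ‖ubar σ N Φ φ s z x‖ ^ p ≤ (V + ∑ i, a i * f i) ^ p :=
            pow_le_pow_left₀ (norm_nonneg _) hnorm p
        _ ≤ 2 ^ (p - 1) * (V ^ p + (∑ i, a i * f i) ^ p) := add_pow_le hV hsum0 p
        _ ≤ 2 ^ (p - 1) * (V ^ p + ∑ i, a i * f i ^ p) := by gcongr
    -- multiply by `W`
    have hWf : W * ∑ i, a i * f i ^ p = ∑ i, w i * fastPow p V (Φ.flow s z i).2 := by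
      rw [Finset.mul_sum]
      refine Finset.sum_congr rfl fun i _ => ?_
      rw [hf, fastPow_one_pow hp, ha]
      simp only
      field_simp
    calc W * ‖ubar σ N Φ φ s z x‖ ^ p ≤ W * (2 ^ (p - 1) * (V ^ p + ∑ i, a i * f i ^ p)) :=
          mul_le_mul_of_nonneg_left hpow hWpos.le
      _ = 2 ^ (p - 1) * (V ^ p * W + ∑ i, w i * fastPow p V (Φ.flow s z i).2) := by
          rw [← hWf]; ring

/-! ## The tests and the exponential moment -/

/-- The stress tests have Frobenius norm at most `1`. -/
theorem normSqT_C2_le_one (j k : Fin 3) : normSqT (C2 j k) ≤ 1 := by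
  unfold normSqT
  rw [Reduction.sum_tens_two]
  simp only [C2, Matrix.cons_val_zero, Matrix.cons_val_one, Fin.sum_univ_three]
  fin_cases j <;> fin_cases k <;> simp <;> norm_num

/-- The heat-flux tests have Frobenius norm at most `1`. -/
theorem normSqT_C3_le_one (a : Fin 3) : normSqT (C3 a) ≤ 1 := by
  unfold normSqT
  rw [Reduction.sum_tens_three]
  simp only [C3, Matrix.cons_val_zero, Matrix.cons_val_one, Fin.sum_univ_three]
  fin_cases a <;> simp <;> norm_num

/-- The EXPONENTIAL VELOCITY MOMENT of a configuration at rate `λ`: `(N+1)⁻¹ Σ_i e^{λ‖v_i‖²}`. -/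
def expMoment (lam : ℝ) (N : ℕ) (z : Cfg N) : ℝ :=
  ((N + 1 : ℕ) : ℝ)⁻¹ * ∑ i, Real.exp (lam * ‖(z i).2‖ ^ 2)

/-- `0 ≤ expMoment`. -/
theorem expMoment_nonneg (lam : ℝ) (N : ℕ) (z : Cfg N) : 0 ≤ expMoment lam N z :=
  mul_nonneg (inv_nonneg.2 (Nat.cast_nonneg _)) (Finset.sum_nonneg fun _ _ => (Real.exp_pos _).le)

/-- The integrand of `TailsOn` is the exponential moment of the configuration. -/
theorem expMoment_eq (lam : ℝ) (z : Cfg N) :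
    ∫ y, Real.exp (lam * ‖y.2‖ ^ 2) ∂(empiricalMeasure z) = expMoment lam N z :=
  Reduction.integral_empiricalMeasure_real z _

/-- **Fast moments against the exponential moment**, averaged over the particles:
`(N+1)⁻¹ Σ_i fastPow p V v_i ≤ p!/(λV)^p · expMoment`. -/
theorem avg_fastPow_le {lam V : ℝ} (hlam : 0 < lam) (hV : 0 < V) (p : ℕ) (z : Cfg N) :
    ((N + 1 : ℕ) : ℝ)⁻¹ * ∑ i, fastPow p V (z i).2 ≤
      (p.factorial / (lam * V) ^ p) * expMoment lam N z := by
  calc ((N + 1 : ℕ) : ℝ)⁻¹ * ∑ i, fastPow p V (z i).2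
      ≤ ((N + 1 : ℕ) : ℝ)⁻¹ * ∑ i, (p.factorial / (lam * V) ^ p) * Real.exp (lam * ‖(z i).2‖ ^ 2) :=
        mul_le_mul_of_nonneg_left (Finset.sum_le_sum fun i _ => fastPow_le_exp hlam hV p (z i).2)
          (inv_nonneg.2 (Nat.cast_nonneg _))
    _ = (p.factorial / (lam * V) ^ p) * expMoment lam N z := by
        rw [expMoment, ← Finset.mul_sum]
        ring

/-- **Energy against the exponential moment**: `Σ_i ‖v_i‖² ≤ λ⁻¹ (N+1) expMoment`. -/
theorem sum_sq_norm_le_expMoment {lam : ℝ} (hlam : 0 < lam) (z : Cfg N) :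
    ∑ i, ‖(z i).2‖ ^ 2 ≤ lam⁻¹ * (((N + 1 : ℕ) : ℝ) * expMoment lam N z) := by
  have hN : (0 : ℝ) < ((N + 1 : ℕ) : ℝ) := by positivity
  rw [expMoment, ← mul_assoc (((N + 1 : ℕ) : ℝ)), mul_inv_cancel₀ hN.ne', one_mul, Finset.mul_sum]
  exact Finset.sum_le_sum fun i _ => sq_norm_le_inv_mul_exp hlam (z i).2

/-- Registered anchor of this helper file (the unit mass of the block weights, `integral_wgt`). -/
theorem pastDamping_kernel_anchor : ∀ (γ C : ℝ) (φ : ℕ → T3 → ℝ), AdmissibleKernel γ C φ → ∀ (σ : ℝ) (N : ℕ) (Φ : Flow σ N) (s : ℝ) (z : Cfg N) (i : Fin (N + 1)), ∫ x, wgt σ N Φ φ s z x i = 1 :=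
  fun _ _ _ hadm _ _ Φ s z i => integral_wgt hadm Φ s z i

end

end PastDamping
end Summit.AtomisticToContinuum.HydrodynamicLimit.Theorems.ContactSourceDuhamel.TimeLocal
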